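import Mathlib
import Literature.MathematicalPhysics.QuantumFieldTheory.Balaban1983to89.T4TrajectoryModulus

/-!
# `T4Continuum.T4StepLawTransport` — the one-step continuation law in TRANSPORT (Lipschitz ∕ coupling) currency:
# `ContStepLawLipOn`, its affine continuation `respMod_continue`, the owner's `hcont` binder fed VERBATIM
# (`cont_of_contStepLawLipOn_dep` ∕ `_fam`), the coupling socket `norm_integral_sub_le_of_coupling` and the deterministic
# heart of synchronous coupling `orbit_le` (cell `pub-balaban`, sub-cell `t4`, spine estimate NE1′ (node O3b/H2), lineage
# t4-ne1p-p2 = IDEATION seat of row NE1′ (owner lineage t4-ne1p-p1), generation 20 — filed at the owner's invitation, journal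
# 2026-08-20T00:28:37Z; tree target `Summits/QuantumFields/BalabanUV/T4Continuum/Support/`; ADDITIVE — imports
# `T4TrajectoryModulus` ONLY (+ Mathlib))

HONEST FRAMING.  Finite four-torus, rung (B)+1 only — NOT infinite volume, NOT a mass gap, NOT the Clay problem, NOT summit
progress.  «continuum YM on T⁴ ⇐ BetaPertH ∧ nine spine estimates (0/9 proved); BetaPertH ⇐ (D1) ∧ (D4) ∧ CAP+tail; G-an2-4
gates asym, D1 and NE2/3/4».  [folklore] real-number bookkeeping and two Mathlib measure-theory lines, 0 sorry, 0 citations;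
every rate below is a HYPOTHESIS SHAPE of the cell's format, never asserted for Bałaban's densities.  Source: ideation memos
`t4/b2b-balaban-t4-ne1p-p2-g19/NE1p-LIPLAW-g19.md` (format + socket) and `t4/b2b-balaban-t4-ne1p-p2-g20/NE1p-WINDOW-g20.md`.

CONTENTS.
§1 `ContStepLawLipOn 𝒢 E act D dZ Adm Adm′ w a ℓ κ` — the owner's `T4TrajectoryModulus.ContStepLawOn` with the two clauses
   that meet the fluctuation law re-typed in TRANSPORT CURRENCY: `bgLipW` charges `ℓ·δ·Lg` to a class integrand that is
   `Lg`-Lipschitz for a pseudo-distance `dZ` on the fluctuation domain `D` (NOT its oscillation over `D`), and `fluctPairW`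
   books two fluctuations over one background as an admissible pair of the METRIC defect `κ·dZ z z′` (guarded by `δ ≤ w`).
   `respMod_continue`: one step multiplies response moduli by `a + ℓ·κ`.  `contStepLawLipOn_of_on`: the oscillation currency
   is the case `dZ = ` discrete distance, `κ := ω` — the transport format GENERALISES `ContStepLawOn`, never replaces it.
   `cont_of_contStepLawLipOn_dep` ∕ `cont_of_contStepLawLipOn_fam`: the conclusion of `T4TrajectoryModulus.cont_of_contStepLawOn_dep`
   (resp. the per-family indexing `E b k`, `𝒢 b k`, …) VERBATIM, so `transportsFromVar_of_moduli_dep` is fed unchanged; the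
   transverse smallness `ψ^{k−k′}` then lives in `κ b k′ k`, the coupling constant `ℓ b k′ k` is what a transport supplier
   delivers (owner's reading, journal 2026-08-20T00:28:37Z: admissible pairs charge ONLY the declared sup).
§2 `norm_integral_sub_le_of_coupling` ∕ `norm_integral_sub_le_of_lipschitz_coupling` — the socket: a probability coupling
   `π` of two laws with a `π`-a.s. bound on the integrand's increment along the coupled pair bounds the difference of the
   two expectations — NO boundary term, NO density ratio.  This is how ANY coupling supplier delivers `bgLipW`.
§3 `orbit_le` ∕ `dist_le_of_syncCoupling` — synchronous coupling, discrete time: same-noise iterations of a `q`-contraction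
   and of a `β`-perturbation of it inside an invariant set, started together, stay within `β/(1−q)` FOR ALL TIMES
   (deterministic, hence almost sure; with the Langevin step `q = 1 − hκ/2`, `β = hβ′`: `2β′/κ`, step-size free).
What stays a binder: every field of `ContStepLawLipOn` for Bałaban's densities — in particular `bgLipW` (row (w3)⁺ of record
`t4/T4-EST-NE1p-P1.md` §4 in transport currency) and the births' moduli; the supplier priced in the g19∕g20 memos
(Agmon-weighted synchronous coupling on the free-coordinate window) is LOCATED there, not composed here.
-/

namespace Summit.QuantumFields.BalabanUV.T4Continuum.T4StepLawTransport

open MeasureTheory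
open Literature.MathematicalPhysics.QuantumFieldTheory.Balaban1983to89
open T4TermFormat T4TermFormat.Booking T4GatedBooking T4TrajectoryComparison T4TrajectoryModulus

/-! ## §1 The step law in Lipschitz ∕ transport currency -/

section Format

variable {𝒰 F : Type*} [NormedAddCommGroup F]

/-- HYPOTHESIS SHAPE — `T4TrajectoryModulus.ContStepLawOn` with the two clauses that meet the fluctuation law re-typed in
TRANSPORT CURRENCY: `bgLipW` charges `ℓ·δ·Lg` to an integrand that is `Lg`-Lipschitz for the pseudo-distance `dZ` on the
fluctuation domain `D`; `fluctPairW` books two fluctuations over one background as an admissible pair of the METRIC defect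
`κ·dZ z z′` (guarded by `δ ≤ w`, as the lattice supplier `hpair_add` is).  `supCost`, `covariant` verbatim. [folklore] -/
structure ContStepLawLipOn {Z : Type*} (𝒢 : Set (Z → F)) (E : 𝒰 → (Z → F) → F) (act : Z → 𝒰 → 𝒰) (D : Set Z)
    (dZ : Z → Z → ℝ) (Adm Adm' : 𝒰 → 𝒰 → ℝ → Prop) (w a ℓ κ : ℝ) : Prop where
  /-- sup cost of `E U₀` on differences of class integrands, at admissible bases (verbatim) -/
  supCost : ∀ (U₀ U₁ : 𝒰) (δ : ℝ), Adm U₀ U₁ δ → δ ≤ w → ∀ g ∈ 𝒢, ∀ g' ∈ 𝒢, ∀ (m : ℝ),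
    (∀ z ∈ D, ‖g z - g' z‖ ≤ m) → ‖E U₀ g - E U₀ g'‖ ≤ a * m
  /-- background Lipschitz against the `dZ`-LIPSCHITZ CONSTANT of a class integrand (transport currency) -/
  bgLipW : ∀ (U₀ U₁ : 𝒰) (δ : ℝ), Adm U₀ U₁ δ → δ ≤ w → ∀ g ∈ 𝒢, ∀ (Lg : ℝ), 0 ≤ Lg →
    (∀ z ∈ D, ∀ z' ∈ D, ‖g z - g z'‖ ≤ Lg * dZ z z') → ‖E U₁ g - E U₀ g‖ ≤ ℓ * δ * Lg
  /-- admissibility survives a common fluctuation (verbatim) -/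
  covariant : ∀ (U₀ U₁ : 𝒰) (δ : ℝ), Adm U₀ U₁ δ → ∀ z ∈ D, Adm' (act z U₀) (act z U₁) δ
  /-- two distinct fluctuations over one background: an admissible pair of METRIC defect `κ·dZ z z′` -/
  fluctPairW : ∀ (U₀ U₁ : 𝒰) (δ : ℝ), Adm U₀ U₁ δ → δ ≤ w → ∀ z ∈ D, ∀ z' ∈ D, z ≠ z' →
    Adm' (act z' U₁) (act z U₁) (κ * dZ z z')
  /-- metric defects stay inside the window -/
  pairW_le : ∀ z ∈ D, ∀ z' ∈ D, κ * dZ z z' ≤ w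
  /-- `0 ≤ κ` -/
  κ_nonneg : 0 ≤ κ
  /-- `0 ≤ dZ` on `D` -/
  dZ_nonneg : ∀ z ∈ D, ∀ z' ∈ D, 0 ≤ dZ z z'

/-- **THE AFFINE CONTINUATION LAW IN TRANSPORT CURRENCY**: one step multiplies moduli by `a + ℓ·κ`.  Proof = the owner's
`ContStepLawOn.respMod_continue` with the oscillation `M·ω` replaced by the Lipschitz constant `M·κ` for `dZ` (the `z = z′`
guard kept). [folklore] -/
theorem ContStepLawLipOn.respMod_continue {Z : Type*} {𝒢 : Set (Z → F)} {E : 𝒰 → (Z → F) → F} {act : Z → 𝒰 → 𝒰}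
    {D : Set Z} {dZ : Z → Z → ℝ} {Adm Adm' : 𝒰 → 𝒰 → ℝ → Prop} {w a ℓ κ M : ℝ}
    (hlaw : ContStepLawLipOn 𝒢 E act D dZ Adm Adm' w a ℓ κ)
    {G : 𝒰 → F} (hG𝒢 : ∀ U, (fun z => G (act z U)) ∈ 𝒢) (hM : 0 ≤ M) (hG : RespMod G Adm' w M) :
    RespMod (fun U => E U (fun z => G (act z U))) Adm w ((a + ℓ * κ) * M) := by
  intro U₀ U₁ δ hadm hδ
  have h2 : ‖E U₀ (fun z => G (act z U₁)) - E U₀ (fun z => G (act z U₀))‖ ≤ a * (M * δ) :=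
    hlaw.supCost U₀ U₁ δ hadm hδ _ (hG𝒢 U₁) _ (hG𝒢 U₀) (M * δ)
      fun z hz => hG _ _ δ (hlaw.covariant U₀ U₁ δ hadm z hz) hδ
  have h1 : ‖E U₁ (fun z => G (act z U₁)) - E U₀ (fun z => G (act z U₁))‖ ≤ ℓ * δ * (M * κ) := by
    refine hlaw.bgLipW U₀ U₁ δ hadm hδ _ (hG𝒢 U₁) (M * κ) (mul_nonneg hM hlaw.κ_nonneg) fun z hz z' hz' => ?_
    by_cases hzz : z = z'
    · subst hzz
      rw [sub_self, norm_zero]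
      exact mul_nonneg (mul_nonneg hM hlaw.κ_nonneg) (hlaw.dZ_nonneg z hz z hz)
    · calc ‖G (act z U₁) - G (act z' U₁)‖ ≤ M * (κ * dZ z z') :=
            hG _ _ _ (hlaw.fluctPairW U₀ U₁ δ hadm hδ z hz z' hz' hzz) (hlaw.pairW_le z hz z' hz')
        _ = M * κ * dZ z z' := by ring
  calc ‖E U₁ (fun z => G (act z U₁)) - E U₀ (fun z => G (act z U₀))‖
      ≤ ‖E U₁ (fun z => G (act z U₁)) - E U₀ (fun z => G (act z U₁))‖ +
          ‖E U₀ (fun z => G (act z U₁)) - E U₀ (fun z => G (act z U₀))‖ :=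
        norm_sub_le_norm_sub_add_norm_sub _ _ _
    _ ≤ ℓ * δ * (M * κ) + a * (M * δ) := add_le_add h1 h2
    _ = (a + ℓ * κ) * M * δ := by ring

/-- CONSISTENCY — the oscillation currency is the case `dZ := ` discrete distance on `D`, `κ := ω`: an `ℓ·δ·m` charge
against the oscillation `m` is an `ℓ·δ·Lg` charge against the Lipschitz constant for the distance-one pseudo-metric.  So the
transport format GENERALISES, never replaces, `ContStepLawOn`. [folklore] -/
theorem contStepLawLipOn_of_on {Z : Type*} [DecidableEq Z] {𝒢 : Set (Z → F)} {E : 𝒰 → (Z → F) → F}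
    {act : Z → 𝒰 → 𝒰} {D : Set Z} {Adm Adm' : 𝒰 → 𝒰 → ℝ → Prop} {w a ℓ ω : ℝ}
    (h : ContStepLawOn 𝒢 E act D Adm Adm' w a ℓ ω) :
    ContStepLawLipOn 𝒢 E act D (fun z z' => if z = z' then 0 else 1) Adm Adm' w a ℓ ω where
  supCost := h.supCost
  bgLipW := fun U₀ U₁ δ hadm hδ g hg Lg hLg hLip =>
    h.bgLip U₀ U₁ δ hadm hδ g hg Lg fun z hz z' hz' => by
      have := hLip z hz z' hz'
      by_cases hzz : z = z'
      · subst hzz; simpa using hLg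
      · simpa [hzz] using this
  covariant := h.covariant
  fluctPairW := fun U₀ U₁ δ hadm _ z hz z' hz' hzz => by simpa [hzz] using h.fluctPair U₀ U₁ δ hadm z hz z' hz' hzz
  pairW_le := fun z _ z' _ => by
    by_cases hzz : z = z'
    · simpa [hzz] using h.ω_nonneg.trans h.ω_le
    · simpa [hzz] using h.ω_le
  κ_nonneg := h.ω_nonneg
  dZ_nonneg := fun z _ z' _ => by by_cases hzz : z = z' <;> simp [hzz]

variable {B : Booking} {T : Trajectory B}

/-- **THE OWNER'S `hcont` BINDER FROM TRANSPORT-CURRENCY STEP LAWS, SCALE-DEPENDENT ADMISSIBILITY** —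
`T4TrajectoryModulus.cont_of_contStepLawOn_dep` with `ContStepLawLipOn (𝒢 k) (E k) (act k) (D k) (dZ k) … (κ b k′ k)` and
the domination `a k + ℓ b k′ k·κ b k′ k ≤ α k`; SAME CONCLUSION SHAPE, so `transportsFromVar_of_moduli_dep` is fed
unchanged. [folklore] -/
theorem cont_of_contStepLawLipOn_dep {Z : Type*} {Gate : ℕ → Prop} {Fn : B.Birth → ℕ → ℕ → 𝒰 → F}
    {Adm : B.Birth → ℕ → ℕ → 𝒰 → 𝒰 → ℝ → Prop} {𝒢 : ℕ → Set (Z → F)} {E : ℕ → 𝒰 → (Z → F) → F}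
    {act : ℕ → Z → 𝒰 → 𝒰} {D : ℕ → Set Z} {dZ : ℕ → Z → Z → ℝ} {a α : ℕ → ℝ} {ℓ κ : B.Birth → ℕ → ℕ → ℝ}
    {w : ℝ}
    (hAdm : ∀ b k' k U₀ U₁ δ, Adm b k' k U₀ U₁ δ → 0 ≤ δ)
    (hFn : ∀ (b : B.Birth) (k' k : ℕ), B.birthScale b ≤ k' → k' ≤ k → k + 1 ≤ B.K → RanBelow Gate (k + 1) →
      ∀ U, Fn b k' (k + 1) U = E k U (fun z => Fn b k' k (act k z U)))
    (h𝒢 : ∀ (b : B.Birth) (k' k : ℕ), B.birthScale b ≤ k' → k' ≤ k → k + 1 ≤ B.K → RanBelow Gate (k + 1) →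
      ∀ U, (fun z => Fn b k' k (act k z U)) ∈ 𝒢 k)
    (hlaw : ∀ (b : B.Birth) (k' k : ℕ), B.birthScale b ≤ k' → k' ≤ k → k + 1 ≤ B.K → RanBelow Gate (k + 1) →
      ContStepLawLipOn (𝒢 k) (E k) (act k) (D k) (dZ k) (Adm b k' (k + 1)) (Adm b k' k) w (a k) (ℓ b k' k)
        (κ b k' k))
    (hdom : ∀ (b : B.Birth) (k' k : ℕ), B.birthScale b ≤ k' → k' ≤ k → k + 1 ≤ B.K →
      a k + ℓ b k' k * κ b k' k ≤ α k) :
    ∀ (b : B.Birth) (k' k : ℕ), B.birthScale b ≤ k' → k' ≤ k → k + 1 ≤ B.K → RanBelow Gate (k + 1) →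
      ∀ M : ℝ, 0 ≤ M → RespMod (Fn b k' k) (Adm b k' k) w M →
        RespMod (Fn b k' (k + 1)) (Adm b k' (k + 1)) w (α k * M) := by
  intro b k' k hbk' hk'k hk hran M hM hG
  have h := ((hlaw b k' k hbk' hk'k hk hran).respMod_continue (h𝒢 b k' k hbk' hk'k hk hran) hM hG).congr_fun
    (hFn b k' k hbk' hk'k hk hran)
  exact h.mono (hAdm b k' (k + 1)) (mul_le_mul_of_nonneg_right (hdom b k' k hbk' hk'k hk) hM)

/-- … and PER FAMILY (the indexing of `T4TrajectoryDensityPerFamily.cont_of_contStepLawOn_fam`: `E b k`, `𝒢 b k`, `act b k`,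
`D b k`, `dZ b k`, `a b k`), SAME conclusion. [folklore] -/
theorem cont_of_contStepLawLipOn_fam {Z : Type*} {Gate : ℕ → Prop} {Fn : B.Birth → ℕ → ℕ → 𝒰 → F}
    {Adm : B.Birth → ℕ → ℕ → 𝒰 → 𝒰 → ℝ → Prop} {𝒢 : B.Birth → ℕ → Set (Z → F)}
    {E : B.Birth → ℕ → 𝒰 → (Z → F) → F} {act : B.Birth → ℕ → Z → 𝒰 → 𝒰} {D : B.Birth → ℕ → Set Z}
    {dZ : B.Birth → ℕ → Z → Z → ℝ} {a : B.Birth → ℕ → ℝ} {α : ℕ → ℝ} {ℓ κ : B.Birth → ℕ → ℕ → ℝ} {w : ℝ}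
    (hAdm : ∀ b k' k U₀ U₁ δ, Adm b k' k U₀ U₁ δ → 0 ≤ δ)
    (hFn : ∀ (b : B.Birth) (k' k : ℕ), B.birthScale b ≤ k' → k' ≤ k → k + 1 ≤ B.K → RanBelow Gate (k + 1) →
      ∀ U, Fn b k' (k + 1) U = E b k U (fun z => Fn b k' k (act b k z U)))
    (h𝒢 : ∀ (b : B.Birth) (k' k : ℕ), B.birthScale b ≤ k' → k' ≤ k → k + 1 ≤ B.K → RanBelow Gate (k + 1) →
      ∀ U, (fun z => Fn b k' k (act b k z U)) ∈ 𝒢 b k)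
    (hlaw : ∀ (b : B.Birth) (k' k : ℕ), B.birthScale b ≤ k' → k' ≤ k → k + 1 ≤ B.K → RanBelow Gate (k + 1) →
      ContStepLawLipOn (𝒢 b k) (E b k) (act b k) (D b k) (dZ b k) (Adm b k' (k + 1)) (Adm b k' k) w (a b k)
        (ℓ b k' k) (κ b k' k))
    (hdom : ∀ (b : B.Birth) (k' k : ℕ), B.birthScale b ≤ k' → k' ≤ k → k + 1 ≤ B.K →
      a b k + ℓ b k' k * κ b k' k ≤ α k) :
    ∀ (b : B.Birth) (k' k : ℕ), B.birthScale b ≤ k' → k' ≤ k → k + 1 ≤ B.K → RanBelow Gate (k + 1) →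
      ∀ M : ℝ, 0 ≤ M → RespMod (Fn b k' k) (Adm b k' k) w M →
        RespMod (Fn b k' (k + 1)) (Adm b k' (k + 1)) w (α k * M) := by
  intro b k' k hbk' hk'k hk hran M hM hG
  have h := ((hlaw b k' k hbk' hk'k hk hran).respMod_continue (h𝒢 b k' k hbk' hk'k hk hran) hM hG).congr_fun
    (hFn b k' k hbk' hk'k hk hran)
  exact h.mono (hAdm b k' (k + 1)) (mul_le_mul_of_nonneg_right (hdom b k' k hbk' hk'k hk) hM)

end Format

/-! ## §2 The transport socket: a coupling with bounded displacement gives `bgLipW` -/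

section Socket

variable {Z F : Type*} [MeasurableSpace Z] [NormedAddCommGroup F] [NormedSpace ℝ F]

/-- **COUPLING ⇒ LIPSCHITZ RESPONSE, NO BOUNDARY TERM, NO DENSITY RATIO.**  If `π` is a probability coupling of the laws
`P₀`, `P₁` (its marginals), the integrand `g` is `P₀`- and `P₁`-integrable, and `π`-almost surely the integrand's increment
along the coupled pair is at most `c`, then `‖∫ g dP₁ − ∫ g dP₀‖ ≤ c`.  The socket through which ANY coupling supplier
(synchronous coupling, exact Gaussian transport, Dobrushin-type comparison) delivers `bgLipW`. [folklore] -/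
theorem norm_integral_sub_le_of_coupling (π : Measure (Z × Z)) [IsProbabilityMeasure π] {P₀ P₁ : Measure Z}
    (h₀ : π.map Prod.fst = P₀) (h₁ : π.map Prod.snd = P₁) {g : Z → F} (hg₀ : Integrable g P₀)
    (hg₁ : Integrable g P₁) {c : ℝ} (hc : ∀ᵐ p ∂π, ‖g p.2 - g p.1‖ ≤ c) :
    ‖∫ z, g z ∂P₁ - ∫ z, g z ∂P₀‖ ≤ c := by
  subst h₀ h₁
  have i₀ : Integrable (fun p : Z × Z => g p.1) π := hg₀.comp_measurable measurable_fst
  have i₁ : Integrable (fun p : Z × Z => g p.2) π := hg₁.comp_measurable measurable_snd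
  rw [integral_map measurable_snd.aemeasurable hg₁.aestronglyMeasurable,
    integral_map measurable_fst.aemeasurable hg₀.aestronglyMeasurable, ← integral_sub i₁ i₀]
  simpa using norm_integral_le_of_norm_le_const hc

/-- The Lipschitz form actually consumed by `bgLipW`: `Lg`-Lipschitz integrand for `dZ` on a set `D` carrying both coupled
coordinates `π`-a.s., `π`-a.s. displacement `≤ disp`, gives `‖∫ g dP₁ − ∫ g dP₀‖ ≤ Lg·disp`. [folklore] -/
theorem norm_integral_sub_le_of_lipschitz_coupling (π : Measure (Z × Z)) [IsProbabilityMeasure π]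
    {P₀ P₁ : Measure Z} (h₀ : π.map Prod.fst = P₀) (h₁ : π.map Prod.snd = P₁) {g : Z → F}
    (hg₀ : Integrable g P₀) (hg₁ : Integrable g P₁) {D : Set Z} {dZ : Z → Z → ℝ} {Lg disp : ℝ} (hLg : 0 ≤ Lg)
    (hLip : ∀ z ∈ D, ∀ z' ∈ D, ‖g z - g z'‖ ≤ Lg * dZ z z') (hD : ∀ᵐ p ∂π, p.1 ∈ D ∧ p.2 ∈ D)
    (hdisp : ∀ᵐ p ∂π, dZ p.2 p.1 ≤ disp) : ‖∫ z, g z ∂P₁ - ∫ z, g z ∂P₀‖ ≤ Lg * disp := by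
  refine norm_integral_sub_le_of_coupling π h₀ h₁ hg₀ hg₁ ?_
  filter_upwards [hD, hdisp] with p hp hdp
  exact (hLip p.2 hp.2 p.1 hp.1).trans (mul_le_mul_of_nonneg_left hdp hLg)

end Socket

/-! ## §3 The deterministic heart of synchronous coupling -/

section SyncCoupling

/-- **SYNCHRONOUS COUPLING, DISCRETE TIME, INSIDE AN INVARIANT SET.**  A pseudo-distance `d` (triangle inequality,
`d z z = 0`), one-step maps `T₀ n`, `T₁ n` preserving `S` (the SAME noise realisation at time `n` absorbed into both — that
is what "synchronous" means), `T₁ n` a `q`-contraction on `S` (`0 ≤ q < 1`), `T₀ n` within `β` of `T₁ n` on `S` (the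
drift perturbation: background `U₀` versus `U₁`): orbits started at one point of `S` satisfy `d (x n) (y n) ≤ β/(1 − q)` for
EVERY `n` — a deterministic, hence almost-sure, uniform-in-time displacement bound.  With the projected Langevin step on the
free-coordinate window (`q = 1 − hκ/2`, `β = hβ′`): `2β′/κ`, step-size free. [folklore] -/
theorem orbit_le {X : Type*} (d : X → X → ℝ) (htri : ∀ a b c, d a c ≤ d a b + d b c) (hdiag : ∀ z, d z z = 0)
    (S : Set X) (T₀ T₁ : ℕ → X → X) {q β : ℝ} (hq₀ : 0 ≤ q) (hq₁ : q < 1) (hβ : 0 ≤ β)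
    (hS₀ : ∀ n, ∀ x ∈ S, T₀ n x ∈ S) (hS₁ : ∀ n, ∀ x ∈ S, T₁ n x ∈ S)
    (hcontr : ∀ n, ∀ x ∈ S, ∀ y ∈ S, d (T₁ n x) (T₁ n y) ≤ q * d x y)
    (hpert : ∀ n, ∀ x ∈ S, d (T₀ n x) (T₁ n x) ≤ β)
    (x y : ℕ → X) (hx : ∀ n, x (n + 1) = T₀ n (x n)) (hy : ∀ n, y (n + 1) = T₁ n (y n)) (h0 : x 0 = y 0)
    (hx0 : x 0 ∈ S) : ∀ n, d (x n) (y n) ≤ β / (1 - q) := by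
  have h1q : 0 < 1 - q := sub_pos.mpr hq₁
  have hB : 0 ≤ β / (1 - q) := div_nonneg hβ h1q.le
  have key : ∀ n, x n ∈ S ∧ y n ∈ S ∧ d (x n) (y n) ≤ β / (1 - q) := by
    intro n
    induction n with
    | zero => exact ⟨hx0, h0 ▸ hx0, by rw [h0, hdiag]; exact hB⟩
    | succ n ih =>
      obtain ⟨hxS, hyS, hd⟩ := ih
      refine ⟨hx n ▸ hS₀ n _ hxS, hy n ▸ hS₁ n _ hyS, ?_⟩
      rw [hx n, hy n]
      calc d (T₀ n (x n)) (T₁ n (y n))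
          ≤ d (T₀ n (x n)) (T₁ n (x n)) + d (T₁ n (x n)) (T₁ n (y n)) := htri _ _ _
        _ ≤ β + q * d (x n) (y n) := add_le_add (hpert n _ hxS) (hcontr n _ hxS _ hyS)
        _ ≤ β + q * (β / (1 - q)) := by gcongr
        _ = β / (1 - q) := by field_simp; ring
  exact fun n => (key n).2.2

/-- The pseudo-metric-space form (no invariant set): two orbits under `q`-contractions `T₁ n` and `β`-perturbations `T₀ n`
from a common start stay within `β/(1 − q)`. [folklore] -/
theorem dist_le_of_syncCoupling {E : Type*} [PseudoMetricSpace E] (T₀ T₁ : ℕ → E → E) {q β : ℝ} (hq₀ : 0 ≤ q)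
    (hq₁ : q < 1) (hβ : 0 ≤ β) (hcontr : ∀ n x y, dist (T₁ n x) (T₁ n y) ≤ q * dist x y)
    (hpert : ∀ n x, dist (T₀ n x) (T₁ n x) ≤ β) (x y : ℕ → E) (hx : ∀ n, x (n + 1) = T₀ n (x n))
    (hy : ∀ n, y (n + 1) = T₁ n (y n)) (h0 : x 0 = y 0) : ∀ n, dist (x n) (y n) ≤ β / (1 - q) :=
  orbit_le dist dist_triangle dist_self Set.univ T₀ T₁ hq₀ hq₁ hβ (fun _ _ _ => trivial) (fun _ _ _ => trivial)
    (fun n a _ b _ => hcontr n a b) (fun n a _ => hpert n a) x y hx hy h0 trivial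

end SyncCoupling

end Summit.QuantumFields.BalabanUV.T4Continuum.T4StepLawTransport
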